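import Summits.ABC.IUTFork.LanaBadPlace
import Summits.ABC.IUTFork.LanaLogLinkLiftingChecks
import Literature.IUT.HodgeArakelov.AbsTopMonoidsGenuineOfSettingPadicClosure
import Literature.AnabelianGeometry.AbsoluteAnabelian.GaloisPadicLogTower
import Literature.AnabelianGeometry.AbsoluteAnabelian.MonoidKummerMapsProofs
import Literature.AnabelianGeometry.AbsoluteAnabelian.MonoidKummerMapsTLGLiftTemperedProofs
import Literature.NumberTheory.GaloisRepresentations.LocalFieldFiniteExtensionIntegers
import HarnessLib

/-!
# L-LANA objects IX octies: `UniqueLifting` at a BAD place (tempered `Π_v`), the named facts DISCHARGED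

Record-only, proof-only sequel (D-0012; seat abc-iut-w6-d027 gen 2, row «LANA-BADPLACE-LIFTING»; L-LANA level,
plan/LLANA-SPEC N12) of `LanaBadPlace.lean` (the bad-place reference datum `RefLocalDatum.ofTemperedCurve X`: `K̄_v = ℚ̄_p`,
`G_v = G_K ≤ Gal(ℚ̄_p/ℚ_p)`, `Π_v := Π^temp_{X_K}` TEMPERED, `Π_v ↠ G_v` the augmentation) and the BAD-PLACE twin of
`LanaLogLinkLiftingHolds.lean` §Good; TAKES NO SIDE on [IUTchIII] Cor. 3.12.  LANA §5.3 (a) p. 29 ("any isomorphism of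
`D`-prime strips can be uniquely lifted to an isomorphism of `F`-prime strips", [IUTchI] Cor. 5.3 (ii)) was reduced,
place by place, to layer L4's NAMED facts `PairIsoDeterminedByGalois` ([AbsTopIII] Prop. 3.2 (iv), injectivity) and
the schema `GaloisIsoLiftsToTMPairIso H` (bijectivity for pairs of "hyperbolic orbicurve type" `H`) — see
`LanaLogLinkLifting.lean` §3.  At GOOD places (`Π_v` profinite) both are theorems (`LanaLogLinkLiftingHolds`).  At a BAD
place `Π_v = Π^temp_{X_v}` is tempered, NOT σ-compact; the schema is nevertheless a theorem there by
`MonoidKummerMapsTLGLiftTemperedProofs.galoisIsoLiftsToTMPairIso_of_isTempered_holds` (open mapping theorem for tempered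
groups, [SemiAnbd] Ex. 3.10, over abc-iut-L6-t13's open-augmentation closers).  THIS file plugs it in:

* `mem_integer_intermediateField_iff`, `intMonoid_eq_nonzeroIntegers_intermediateField` — for a finite
  `K ⊆ ℚ̄_p` with its extended valuation (`FiniteExtension.valuativeRel`): `𝒪_K = {c : ‖c‖_{ℚ̄_p} ≤ 1}` (Serre II §2
  Prop. 3: `𝒪_K` = integral closure of `ℤ_p`) and hence LANA's `O^▷_{ℚ̄_p} = {0 < |x| ≤ 1}` IS [AbsTopIII]'s
  `𝒪^⊳_{ℚ̄_p}` OVER `𝒪_K` (the model monoid `nonzeroIntegers K ℚ̄_p` of `MLFClosure.ofFiniteSubfield p K`);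
* `badRef_stabilizer_isOpen`, `badPair X` — `F_v = (Π^temp_{X_K} ↷ O^▷_{ℚ̄_p})` as an [AbsTopIII] Def. 3.1 (ii) pair;
  `badModelData X` — Def. 3.1 (i) model data over `(K, ℚ̄_p)` (`TemperedCurve.mlfClosurePadic`) with `Π_k := Π^temp_{X_K}`,
  `ε_k := ε ∘ (Π^temp ↠ G_K)` (abc-iut-w5-d233's choice-free `galoisEpsilonPadic`, `σ ↦ σ`); `badPairIsoModel`;
  **`isMLFGaloisMonoidPair_badPair`** — the bad-place `F_v` IS an MLF-Galois `TM`-pair (a theorem, no hypothesis);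
* **`bad_liftUnique` — the UNIQUENESS half of LANA's unique lifting at every bad-place datum, UNCONDITIONALLY**
  (`pairIsoDeterminedByGalois_holds`), hence `logLink_lift_unique_bad`;
* `gK_eq_one_of_forall_smul_intMonoid`, `badPair_actionKer` (`= Δ^temp_X`), `badPair_isTopCharacteristic_iff`;
* **`bad_liftExists_of_char_of_cont`** — the EXISTENCE half at a bad-place datum from «`Π^temp_{X_K}` tempered +
  Galois-countable» (L3's parameter bundle `X.GroupLevelData`, ruling η′), the characteristicity of
  `Δ^temp_X ⊆ Π^temp_{X_K}` under topological automorphisms ((H1); [SemiAnbd] Cor. 3.11-type input, NOT proved here)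
  and the continuity clause `hcont` ALONE — the schema being instantiated at `H := «Π tempered ∧ first-countable»`;
  `bad_uniqueLifting_of_char_of_cont` for a family of bad-place data.

`LanaLogLinkLifting.uniqueLifting_of_ref` takes its inputs place by place, so mixed families (good AND bad places)
combine `good_liftExists_of_char_of_cont` / `good_liftUnique` with the present `bad_…` theorems.

HONEST SCOPE. (i) `hcont` (LANA Def. 3.7.1) is NOT discharged (cf. `LanaLogLinkLiftingHolds` (i)).  (ii) `hker` =
«`Δ^temp_X` is characteristic in `Π^temp_{X_K}`» is the genuine anabelian input at bad places ((H1) of the cell's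
[IUTchII] §1 files).  (iii) Nothing here says that `X` IS the `π₁^temp` of the curve `X_v` of the initial Θ-data
(L3's origin certificate, threaded by the consumer).  [cite: LANA2026Report, §5.3 (a) p. 29, §3.8 (a) pp. 20–21]
[cite: MochizukiAbsTopIII2015, Proposition 3.2 (iv) p.72] [cite: MochizukiSemiAnbd2006, Ex 3.10 p.43]
NOT here: any judgement.
-/

noncomputable section

namespace Summit.ABC
namespace IUTFork

open Literature.AnabelianGeometry.AbsoluteAnabelian
open Literature.AnabelianGeometry.SemiGraphs
open Literature.NumberTheory.GaloisRepresentations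
open scoped NNReal ValuativeRel

variable {p : ℕ} [Fact p.Prime]

/-! ## 0. `𝒪_K` and `𝒪^⊳_{ℚ̄_p}` over a finite `K ⊆ ℚ̄_p` -/

/-- **`𝒪_K = {c ∈ K : ‖c‖_{ℚ̄_p} ≤ 1}`** for a finite `K ⊆ ℚ̄_p` with the extended valuation of `ℚ_p`
(`FiniteExtension.valuativeRel`, the structure of `MLFClosure.ofFiniteSubfield p K`): `𝒪_K` is the integral closure of
`ℤ_p = 𝒪[ℚ_p]` (Serre II §2 Prop. 3, tree `FiniteExtension.mem_integer_iff_isIntegral`), integrality is insensitive to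
the embedding `K ⊆ ℚ̄_p`, and `𝒪_{ℚ̄_p} = {‖x‖ ≤ 1}` (`PadicAlgCl.isIntegral_iff_norm_le_one`).
[cite: SerreLocalFields1979, Ch. II §2 Prop. 3] -/
theorem mem_integer_intermediateField_iff (K : IntermediateField ℚ_[p] (PadicAlgCl p))
    [FiniteDimensional ℚ_[p] K] (c : K) :
    letI : IsNonarchimedeanLocalField ℚ_[p] := Padic.isNonarchimedeanLocalField_holds p
    letI := FiniteExtension.valuativeRel ℚ_[p] K
    c ∈ 𝒪[K] ↔ ‖algebraMap K (PadicAlgCl p) c‖ ≤ 1 := by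
  letI : IsNonarchimedeanLocalField ℚ_[p] := Padic.isNonarchimedeanLocalField_holds p
  letI := FiniteExtension.valuativeRel ℚ_[p] K
  rw [FiniteExtension.mem_integer_iff_isIntegral ℚ_[p] K c, ← PadicAlgCl.isIntegral_iff_norm_le_one]
  have hf : Function.Injective ((IntermediateField.val K).restrictScalars 𝒪[ℚ_[p]]) :=
    fun a b h => Subtype.ext h
  exact (isIntegral_algHom_iff ((IntermediateField.val K).restrictScalars 𝒪[ℚ_[p]]) hf).symm

/-- **LANA's `O^▷_{ℚ̄_p}` IS [AbsTopIII]'s `𝒪^⊳_{ℚ̄_p}` over `𝒪_K`** for every finite `K ⊆ ℚ̄_p`: an element of `ℚ̄_p`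
has valuation in `(0, 1]` iff it is non-zero and integral over `𝒪_K` (abc-iut-L4's `mem_integersClosure_tower_iff`
over the base `K` of the tower `ℚ_p ⊆ K ⊆ ℚ̄_p`, fed with `mem_integer_intermediateField_iff`).
[cite: MochizukiAbsTopIII2015, Definition 3.1 (i) p.66] [cite: LANA2026Report, §0.4 (b) p. 8] -/
theorem intMonoid_eq_nonzeroIntegers_intermediateField (K : IntermediateField ℚ_[p] (PadicAlgCl p))
    [FiniteDimensional ℚ_[p] K] :
    letI : IsNonarchimedeanLocalField ℚ_[p] := Padic.isNonarchimedeanLocalField_holds p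
    letI := FiniteExtension.valuativeRel ℚ_[p] K
    intMonoid (padicVal p) = nonzeroIntegers K (PadicAlgCl p) := by
  letI : IsNonarchimedeanLocalField ℚ_[p] := Padic.isNonarchimedeanLocalField_holds p
  letI := FiniteExtension.valuativeRel ℚ_[p] K
  have hO : ∀ c : K, c ∈ 𝒪[K] ↔ ‖algebraMap K (PadicAlgCl p) c‖ ≤ 1 :=
    mem_integer_intermediateField_iff K
  ext x
  change 0 < Valued.v x ∧ Valued.v x ≤ 1 ↔ x ∈ integersClosure K (PadicAlgCl p) ∧ x ≠ 0
  rw [mem_integersClosure_tower_iff p hO, pos_iff_ne_zero, Valuation.ne_zero_iff, and_comm]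
  refine and_congr_left fun _ => ?_
  rw [PadicAlgCl.valuation_def, ← NNReal.coe_le_coe, coe_nnnorm, NNReal.coe_one]

namespace TemperedCurveRef

variable (X : TemperedCurve p)

/-! ## 1. The bad-place `F_v` as an [AbsTopIII] Def. 3.1 (ii) pair, and its Def. 3.1 (i) model over `(K, ℚ̄_p)` -/

/-- At a bad-place datum, `G_v = G_K ≤ Gal(ℚ̄_p/ℚ_p)` acts on `O^▷_{ℚ̄_p}` with OPEN stabilisers (the stabiliser in
`G_K` is the trace of the open stabiliser in `Gal(ℚ̄_p/ℚ_p)`, `padicRef_stabilizer_isOpen`).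
[cite: MochizukiAbsTopIII2015, Definition 3.1 (ii) p.67] -/
theorem badRef_stabilizer_isOpen (a : intMonoid (padicVal p)) :
    IsOpen (MulAction.stabilizer X.GK a : Set X.GK) := by
  have h : (MulAction.stabilizer X.GK a : Set X.GK) =
      Subtype.val ⁻¹' (MulAction.stabilizer (PadicGal p) a : Set (PadicGal p)) := by
    ext σ
    simp only [SetLike.mem_coe, MulAction.mem_stabilizer_iff, Set.mem_preimage]
    exact Iff.rfl
  rw [h]
  exact (padicRef_stabilizer_isOpen p a).preimage continuous_subtype_val

/-- **The bad-place reference pair `F_v = (Π^temp_{X_K} ↷ O^▷_{ℚ̄_p})`** (through `Π_v ↠ G_K`) as an [AbsTopIII]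
Def. 3.1 (ii) pair. [cite: MochizukiAbsTopIII2015, Definition 3.1 (ii) p.67] [cite: LANA2026Report, §3.10 Table 1 p. 22] -/
abbrev badPair : GaloisMonoidPair.{0} := (RefLocalDatum.ofTemperedCurve X).toPair (badRef_stabilizer_isOpen X)

/-- **The bad-place datum as [AbsTopIII] Def. 3.1 (i) model data over `(K, ℚ̄_p)`** (`TemperedCurve.mlfClosurePadic`):
`Π_k := Π^temp_{X_K}`, `ε_k := ε ∘ (Π^temp_{X_K} ↠ G_K) : Π_k ↠ Gal(ℚ̄_p/K)` with abc-iut-w5-d233's choice-free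
`ε = galoisEpsilonPadic : G_K ⥲ (ℚ̄_p ≃ₐ[K] ℚ̄_p)`, `σ ↦ σ` (continuous, surjective).
[cite: MochizukiAbsTopIII2015, Definition 3.1 (i) p.66] [cite: LANA2026Report, §3.8 (a) pp. 20–21] -/
def badModelData : ModelMLFGaloisData X.mlfClosurePadic.k X.mlfClosurePadic.K where
  Pi := X.PiTemp
  aug := X.galoisEpsilonPadic.toMulEquiv.toMonoidHom.comp (augToGK X).toMonoidHom
  continuous_aug := X.galoisEpsilonPadic.continuous.comp (map_continuous (augToGK X))
  aug_surjective := X.galoisEpsilonPadic.surjective.comp (augToGK_surjective X)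

/-- `ε_k g` acts on `ℚ̄_p` as `aug g ∈ Gal(ℚ̄_p/ℚ_p)` does. [cite: MochizukiSemiAnbd2006, §6 p.69] -/
theorem badModelData_aug_apply (g : X.PiTemp) (x : PadicAlgCl p) :
    (show PadicAlgCl p ≃ₐ[X.K] PadicAlgCl p from (badModelData X).aug g) x = X.aug g x := rfl

/-- LANA's `O^▷_{ℚ̄_p}` is the model monoid `𝒪^⊳_{ℚ̄_p}` over `𝒪_K` of `X.mlfClosurePadic`.
[cite: MochizukiAbsTopIII2015, Definition 3.1 (i) p.66] -/
theorem intMonoid_eq_nonzeroIntegers_mlfClosurePadic :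
    intMonoid (padicVal p) = nonzeroIntegers X.mlfClosurePadic.k X.mlfClosurePadic.K :=
  @intMonoid_eq_nonzeroIntegers_intermediateField p _ X.K X.finiteDimensional_K

/-- **`F_v ≅` the model `TM`-pair of `badModelData`**: identity on `Π^temp_{X_K}`, `O^▷_{ℚ̄_p} = 𝒪^⊳_{ℚ̄_p}` on the
monoids, the same action `g ↦ aug g`. [cite: MochizukiAbsTopIII2015, Definition 3.1 (ii) p.67] -/
def badPairIsoModel : GaloisMonoidPair.Iso (badModelData X).tmPair (badPair X) where
  isoPi := ContinuousMulEquiv.refl _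
  isoM := MulEquiv.submonoidCongr (intMonoid_eq_nonzeroIntegers_mlfClosurePadic X).symm
  smul_comm _ _ := Subtype.ext rfl

/-- **The bad-place `F_v` is an MLF-Galois `TM`-pair** ([AbsTopIII] Def. 3.1 (ii) over `(K, ℚ̄_p)`): the hypothesis
`hMLF` of `liftUnique_of_pairIsoDeterminedByGalois` / `liftExists_of_galoisIsoLifts` is a THEOREM at every bad-place
datum. [cite: MochizukiAbsTopIII2015, Definition 3.1 (ii) p.67] -/
theorem isMLFGaloisMonoidPair_badPair : IsMLFGaloisMonoidPair .TM (badPair X) :=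
  ⟨⟨X.mlfClosurePadic, badModelData X, _, (badModelData X).monoidPair_TM, ⟨badPairIsoModel X⟩⟩⟩

/-! ## 2. Uniqueness half: UNCONDITIONAL -/

/-- **Uniqueness half at every bad-place datum, UNCONDITIONAL**: an automorphism of
`F_v = (Π^temp_{X_K} ↷ O^▷_{ℚ̄_p})` is determined by its `Π_v`-component ([AbsTopIII] Prop. 3.2 (iv) injectivity,
PROVED in the tree as `pairIsoDeterminedByGalois_holds`). [cite: MochizukiAbsTopIII2015, Proposition 3.2 (iv) p.72]
[cite: LANA2026Report, §5.3 (a) p. 29] -/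
theorem bad_liftUnique : (RefLocalDatum.ofTemperedCurve X).LiftUnique :=
  (RefLocalDatum.ofTemperedCurve X).liftUnique_of_pairIsoDeterminedByGalois (badRef_stabilizer_isOpen X)
    (isMLFGaloisMonoidPair_badPair X) pairIsoDeterminedByGalois_holds

/-- **The log-link over bad-place data is unique over its étale isomorphism, UNCONDITIONALLY.**
[cite: LANA2026Report, §5.3 (a) p. 29] [cite: MochizukiAbsTopIII2015, Proposition 3.2 (iv) p.72] -/
theorem logLink_lift_unique_bad {V : Type} [Fintype V] {bad : Finset V} (Xv : V → TemperedCurve p)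
    {HT HT' : HodgeTheater (fun v => RefLocalDatum.ofTemperedCurve (Xv v)) bad} (Lg Lg' : LogLink HT HT')
    (h : Lg.etaleIso = Lg'.etaleIso) : Lg.lift = Lg'.lift :=
  LogLink.lift_unique_of_liftUnique (fun v => bad_liftUnique (Xv v)) Lg Lg' h

/-! ## 3. The arithmetic kernel of the bad-place pair is `Δ^temp_X` -/

/-- `G_K` acts FAITHFULLY on `O^▷_{ℚ̄_p}` (restriction of `padicGal_eq_one_of_forall_smul_intMonoid`). [folklore] -/
theorem gK_eq_one_of_forall_smul_intMonoid (σ : X.GK)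
    (h : ∀ a : intMonoid (padicVal p), σ • a = a) : σ = 1 :=
  Subtype.ext (padicGal_eq_one_of_forall_smul_intMonoid p (σ : PadicGal p) fun a => h a)

/-- **The arithmetic kernel of the bad-place pair is `Δ^temp_X = Ker(Π^temp_{X_K} ↠ G_K)`** ([SemiAnbd] §6 p. 69
exact sequence; `G_K` acts faithfully on `O^▷_{ℚ̄_p}`). [cite: MochizukiAbsTopIII2015, Definition 3.1 (ii) p.67]
[cite: MochizukiSemiAnbd2006, §6 p.69] -/
theorem badPair_actionKer : (badPair X).actionKer = X.DeltaTemp := by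
  rw [(RefLocalDatum.ofTemperedCurve X).toPair_actionKer_eq_ker (badRef_stabilizer_isOpen X)
    (gK_eq_one_of_forall_smul_intMonoid X)]
  ext g
  rw [MonoidHom.mem_ker, TemperedCurve.DeltaTemp, MonoidHom.mem_ker]
  change augToGK X g = 1 ↔ X.aug g = 1
  rw [Subtype.ext_iff, coe_augToGK]
  rfl

/-- Hence the characteristicity clause `hker` of the existence half is `IsTopCharacteristic Π^temp_{X_K} Δ^temp_X`
("the [group-theoretic!] subgroup", (H1)). [cite: MochizukiSemiAnbd2006, §6 p.69] -/
theorem badPair_isTopCharacteristic_iff :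
    Literature.AnabelianGeometry.EtaleTheta.IsTopCharacteristic X.PiTemp (badPair X).actionKer ↔
      Literature.AnabelianGeometry.EtaleTheta.IsTopCharacteristic X.PiTemp X.DeltaTemp := by
  rw [badPair_actionKer]

/-! ## 4. Existence half: from (H1) + the continuity clause, the schema DISCHARGED at tempered `Π` -/

/-- **Existence half at a bad-place datum from characteristicity + continuity ALONE**: `Π_v = Π^temp_{X_K}` is TEMPERED
with first-countable topology, so [AbsTopIII] Prop. 3.2 (iv) bijectivity in the `H`-schema form holds at
`H := «Π tempered ∧ first-countable»` (`galoisIsoLiftsToTMPairIso_of_isTempered_holds`: open mapping theorem for tempered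
groups, [SemiAnbd] Ex. 3.10); what remains is that `Δ^temp_X ⊆ Π^temp_{X_K}` is characteristic under topological
automorphisms ((H1)) and the continuity clause. [cite: MochizukiAbsTopIII2015, Proposition 3.2 (iv) p.72]
[cite: MochizukiSemiAnbd2006, Ex 3.10 p.43] [cite: LANA2026Report, §5.3 (a) p. 29] -/
theorem bad_liftExists_of_char_of_cont [FirstCountableTopology X.PiTemp] (hX : IsTempered X.PiTemp)
    (hker : Literature.AnabelianGeometry.EtaleTheta.IsTopCharacteristic X.PiTemp X.DeltaTemp)
    (hcont : ∀ f : GaloisMonoidPair.Iso (badPair X) (badPair X), Continuous f.isoM ∧ Continuous f.isoM.symm) :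
    (RefLocalDatum.ofTemperedCurve X).LiftExists :=
  (RefLocalDatum.ofTemperedCurve X).liftExists_of_galoisIsoLifts (badRef_stabilizer_isOpen X)
    (isMLFGaloisMonoidPair_badPair X) (H := fun P => IsTempered P.Pi ∧ FirstCountableTopology P.Pi)
    ⟨hX, inferInstance⟩
    (galoisIsoLiftsToTMPairIso_of_isTempered_holds _ fun _ h => h)
    ((badPair_isTopCharacteristic_iff X).mpr hker) hcont

/-- **Existence half from L3's parameter bundle** `d : X.GroupLevelData` ("`Π^temp` tempered", "Galois-countable",
ruling η′) + (H1) + the continuity clause. [cite: MochizukiSemiAnbd2006, Ex 3.10 pp.43-45]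
[cite: LANA2026Report, §5.3 (a) p. 29] -/
theorem bad_liftExists_of_groupLevelData (d : X.GroupLevelData)
    (hker : Literature.AnabelianGeometry.EtaleTheta.IsTopCharacteristic X.PiTemp X.DeltaTemp)
    (hcont : ∀ f : GaloisMonoidPair.Iso (badPair X) (badPair X), Continuous f.isoM ∧ Continuous f.isoM.symm) :
    (RefLocalDatum.ofTemperedCurve X).LiftExists := by
  haveI := d.secondCountableTopology
  exact bad_liftExists_of_char_of_cont X d.isTempered hker hcont

/-- **`UniqueLifting` for a family of BAD-PLACE data from (H1) + continuity ALONE** (the named facts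
`PairIsoDeterminedByGalois`, `GaloisIsoLiftsToTMPairIso H` and `hMLF`, `hH` all discharged).
[cite: LANA2026Report, §5.3 (a) p. 29] [cite: MochizukiAbsTopIII2015, Proposition 3.2 (iv) p.72] -/
theorem bad_uniqueLifting_of_char_of_cont {V : Type} (Xv : V → TemperedCurve p) (d : ∀ v, (Xv v).GroupLevelData)
    (hker : ∀ v, Literature.AnabelianGeometry.EtaleTheta.IsTopCharacteristic (Xv v).PiTemp (Xv v).DeltaTemp)
    (hcont : ∀ v (f : GaloisMonoidPair.Iso (badPair (Xv v)) (badPair (Xv v))),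
      Continuous f.isoM ∧ Continuous f.isoM.symm) :
    UniqueLifting (fun v => RefLocalDatum.ofTemperedCurve (Xv v)) :=
  uniqueLifting_of_ref (fun v => bad_liftExists_of_groupLevelData (Xv v) (d v) (hker v) (hcont v))
    (fun v => bad_liftUnique (Xv v))

end TemperedCurveRef

end IUTFork

end Summit.ABC

end
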